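import Literature.AnabelianGeometry.EtaleTheta.Discharge.Sec5Prop53Toy
import Mathlib.Data.Int.Order.Units
import HarnessLib

/-!
# [EtTh] §5, Prop. 5.3 at a CHAIN MODEL: a §5 toy datum whose base automorphisms TRANSLATE the chain of components;
# every chain automorphism `e = (j ↦ εj + c)` satisfies all six typed clauses (i)–(vi) there
# (model-witness side of the FACT-LIST rows F-0559 / F-0560 / F-0561 / F-0562 / F-0563 / F-0564 / F-2497)

Mochizuki, *The étale theta function …*, Publ. RIMS **45** (2009), §5, Prop. 5.3, pp. 325–327 (PDF pp. 99–101)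
[cite: MochizukiEtTh2009, Prop 5.3 p.325 (PDF p.99)]; the special fibre of `𝔜` is "an infinite chain of copies of the projective
line" translated by `Z = Gal(Y/X) ≅ ℤ` (§1, p. 238 (PDF p. 12)).  Cell abc-iut, block F, seat abc-iut-f-128 (tranche 128; rows leased
by abc-iut-f-009, whose `Sec5Prop53Toy.lean` — `Φ := ⊕_{ℤ ⊔ ℤ} ℚ_{≥0}`, primes `P i`, `idx`, `label`, `canonIso`, `reindex σ`, toy
prime data — is reused BY NAME, and whose sibling file REFUTES the universal closures of the rows with NON-geometric `e`).
PROOF + TOY DATA only: no new `Prop` fact, no edit of abc-iut-L2-t4's statement file `FrobenioidThetaDivisors.lean`.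

WHAT IS NEW.  In the cell's earlier §5 toy data the base is `Discrete PUnit` / constant, so `Aut_C(A_⊚)` acts TRIVIALLY on `Φ(A_⊚)`
and the orbit of Prop. 5.3 (vi) is `{div(Θ̈)}`.  Here `C = D = SingleObj ℤ` (one object `⋆ = A_⊚ = A_N = B_N`, arrows `ℤ`),
`Base = 𝟭`, and the pull-back along `k : ⋆ → ⋆` re-indexes `Φ(⋆) = ⊕_{ℤ ⊔ ℤ} ℚ_{≥0}` along the translation by `k` of the chain
(components `inl n`, cusps `inr n`): `chainTheta` (`Π^tp_X := ℤ × ℤ/2 ↠ Aut_D(B_N^bs) ≅ ℤ` by `pr₁`, `Π^tp_Ÿ := 1` of index `2`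
in the kernel, `K := 𝔽₂`, sections trivial).  `Aut_C(A_⊚) ≅ ℤ` acts through ALL translations (`pullAut_chain`,
`exists_aut_translate`); the orbit of `div(Θ̈) := [x_{inl 0}]` is the whole chain `{[x_{inl k}] | k ∈ ℤ}` (`thetaOrbit_eq`).

RESULT, for EVERY `ε = ±1`, `c ∈ ℤ`, with `Ψ = 𝟭`, `ι = 𝟙`, `e := reindex (chainAut ε c)` (the chain automorphism
`inl n ↦ inl (εn + c)`, `inr n ↦ inr (εn + c)` — the shape of an isomorphism of divisor monoids induced by an automorphism of the
pointed dual graph) and the canonical prime data `chainPrimeData`: (i) `cuspPreserved_chain`, `preservesCuspidality_chain`;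
(ii) `preservesNcspComponentIsos_chain`; (iii) `preservesCspComponentIsos_chain`; (iv) `preservesCspToNcsp_chain`;
(v) `preservesNcspLabels_chain` (witnesses `ε`, `c`); (vi) `preservesThetaDivisorOrbit_chain` (a NON-degenerate orbit carried onto
itself); the conjunction `geometryOfDivisorsPreserved_chain` for the stub `chainTransport` ("`e` is a chain automorphism") and
`geometryOfDivisorsPreserved_of_isInducedBy` for every `e` it admits.  So the six typed clauses are SIMULTANEOUSLY SATISFIED by
non-identity `e` (`reindex_chainAut_xinl`) at a datum with non-trivial `Aut_C(A_⊚)`-action; their universal closures fail only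
through non-geometric `e` / prime data (f-009) — R5 of plan/FACT-LIST.md, "named instances only".
HONEST FRAMING: a toy datum says nothing about the tempered Frobenioid of [EtTh] §5, nothing about the truth of Prop. 5.3 for
it, and nothing about [IUTchIII] Cor. 3.12; no side is taken; typed ≠ proved.
-/

namespace Literature.AnabelianGeometry.EtaleTheta.FrobenioidThetaDivisors.Prop53Chain

open CategoryTheory Literature.AlgebraicGeometry.Frobenioids ConstantMultiple ConstantMultiple.Cor512Toy Prop53Toy

/-- The affine bijection `j ↦ ε·j + c` of `ℤ`, `ε = ±1` ("translation … and multiplication by `±1`", p.325). [cite: MochizukiEtTh2009, Prop 5.3 (v) p.325 (PDF p.99)] -/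
def affine (ε : ℤˣ) (c : ℤ) : ℤ ≃ ℤ where
  toFun j := ε * j + c
  invFun j := ε * (j - c)
  left_inv j := by
    show (ε : ℤ) * (ε * j + c - c) = j
    rw [add_sub_cancel_right, ← mul_assoc, Int.units_coe_mul_self, one_mul]
  right_inv j := by
    show (ε : ℤ) * (ε * (j - c)) + c = j
    rw [← mul_assoc, Int.units_coe_mul_self, one_mul, sub_add_cancel]

/-- **The chain automorphism `(ε, c)`** of `ℤ ⊔ ℤ`: `inl n ↦ inl (εn + c)` (components), `inr n ↦ inr (εn + c)` (cusps) — an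
automorphism of the pointed dual graph of the special fibre. [cite: MochizukiEtTh2009, Prop 5.3 p.325 (PDF p.99)] -/
def chainAut (ε : ℤˣ) (c : ℤ) : Idx ≃ Idx := Equiv.sumCongr (affine ε c) (affine ε c)

/-- `chainAut ε c (inl n) = inl (εn + c)`. [cite: MochizukiEtTh2009, Prop 5.3 p.325 (PDF p.99)] -/
@[simp] theorem chainAut_inl (ε : ℤˣ) (c n : ℤ) : chainAut ε c (Sum.inl n) = Sum.inl (ε * n + c) := rfl

/-- `chainAut ε c (inr n) = inr (εn + c)`. [cite: MochizukiEtTh2009, Prop 5.3 p.325 (PDF p.99)] -/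
@[simp] theorem chainAut_inr (ε : ℤˣ) (c n : ℤ) : chainAut ε c (Sum.inr n) = Sum.inr (ε * n + c) := rfl

/-- `(chainAut ε c)⁻¹ (inl n) = inl (ε (n - c))`. [cite: MochizukiEtTh2009, Prop 5.3 p.325 (PDF p.99)] -/
@[simp] theorem chainAut_symm_inl (ε : ℤˣ) (c n : ℤ) : (chainAut ε c).symm (Sum.inl n) = Sum.inl (ε * (n - c)) := rfl

/-- `(chainAut ε c)⁻¹ (inr n) = inr (ε (n - c))`. [cite: MochizukiEtTh2009, Prop 5.3 p.325 (PDF p.99)] -/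
@[simp] theorem chainAut_symm_inr (ε : ℤˣ) (c n : ℤ) : (chainAut ε c).symm (Sum.inr n) = Sum.inr (ε * (n - c)) := rfl

/-- The translation of the chain by `k` is `chainAut 1 k`. [cite: MochizukiEtTh2009, §1 p.238 (PDF p.12)] -/
abbrev shift (k : ℤ) : Idx ≃ Idx := chainAut 1 k

/-- Components of a re-indexed element, read in `ℚ_{≥0}`: `(reindex σ f)_j = f_{σ⁻¹ j}`. [cite: MochizukiEtTh2009, Prop 5.3 p.325 (PDF p.99)] -/
theorem reindex_apply (σ : Idx ≃ Idx) (f : Φt) (j : Idx) :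
    (((reindex σ f : Φt) : ∀ j, Fac j) j : Multiplicative NNRat) = ((f : ∀ j, Fac j) (σ.symm j) : Multiplicative NNRat) := rfl

/-- Translating by `0` is the identity of `Φ`. [cite: MochizukiEtTh2009, Prop 5.3 p.325 (PDF p.99)] -/
theorem reindex_shift_zero (f : Φt) : reindex (shift 0) f = f :=
  Subtype.ext <| funext fun j => (reindex_apply _ f j).trans <|
    congrArg (fun i => ((f : ∀ j, Fac j) i : Multiplicative NNRat)) (show (shift 0).symm j = j by rcases j with n | n <;> simp)

/-- Translating by `a + b` is translating by `a`, then by `b`. [cite: MochizukiEtTh2009, Prop 5.3 p.325 (PDF p.99)] -/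
theorem reindex_shift_add (a b : ℤ) (f : Φt) : reindex (shift (a + b)) f = reindex (shift b) (reindex (shift a) f) :=
  Subtype.ext <| funext fun j => (reindex_apply _ f j).trans <|
    congrArg (fun i => ((f : ∀ j, Fac j) i : Multiplicative NNRat))
      (show (shift (a + b)).symm j = (shift a).symm ((shift b).symm j) by rcases j with n | n <;> simp <;> ring)

/-- The one-object category on the group `ℤ` (plays `C` and `D`; `⋆` plays `A_⊚ = A_N = B_N`, its automorphism group `ℤ` plays
`Z = Gal(Y/X)` translating the chain). [cite: MochizukiEtTh2009, §1 p.238 (PDF p.12)] -/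
abbrev TZ : Type := SingleObj (Multiplicative ℤ)

/-- The object `⋆` of `SingleObj ℤ`. [cite: MochizukiEtTh2009, §5 p.322 (PDF p.96)] -/
abbrev pt : TZ := SingleObj.star (Multiplicative ℤ)

/-- The chain pre-Frobenioid data: `Base = 𝟭`, `Φ(⋆) = ⊕_{ℤ ⊔ ℤ} ℚ_{≥0}`, pull-back along `k : ⋆ → ⋆` = translation of the
chain by `k`, all divisors `0`, all Frobenius degrees `1`. [cite: MochizukiEtTh2009, Prop 5.3 p.325 (PDF p.99)] -/
def chainPre : PreFrobenioidData.{0} TZ TZ where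
  base := 𝟭 TZ
  Mon := fun _ => Φt
  pull := fun k => (reindex (shift (Multiplicative.toAdd k))).toMonoidHom
  pull_id := fun _ x => reindex_shift_zero x
  pull_comp := fun β α x => reindex_shift_add (Multiplicative.toAdd α) (Multiplicative.toAdd β) x
  div := fun _ => 1
  degFr := fun _ => 1
  div_id := fun _ => rfl
  div_comp := fun _ _ => by simp
  degFr_id := fun _ => rfl
  degFr_comp := fun _ _ => rfl

/-- The chain `TemperedFrobenioidStub`: `O^×(S^birat) := 1` (`O^×(S) = 1` as `Base = 𝟭`), trivial unit pull-backs, every arrow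
"of base-Frobenius type"; `O^×(S) ⊆ Aut(S) ≅ ℤ` is abelian. [cite: MochizukiEtTh2009, §5 p.322 (PDF p.96)] -/
def chainStub : FrobenioidTheta.TemperedFrobenioidStub.{0} TZ TZ where
  pre := chainPre
  units_comm S := ⟨⟨fun a b => Subtype.ext <| Aut.ext <| by
    change b.1.hom ≫ a.1.hom = a.1.hom ≫ b.1.hom
    rw [SingleObj.comp_as_mul, SingleObj.comp_as_mul]
    exact @mul_comm (Multiplicative ℤ) _ a.1.hom b.1.hom⟩⟩
  biratUnits := fun _ => Unit
  unitsToBirat := fun _ => 1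
  unitsToBirat_injective S := by
    intro a b _
    apply Subtype.ext
    apply Aut.ext
    exact a.2.1.trans b.2.1.symm
  unitsPull := fun _ => 1
  IsBaseFrobeniusType := ⊤

/-- `Π^tp_X := ℤ × ℤ/2 ↠ Aut_D(B_N^bs) = Aut(⋆) ≅ ℤ`: `pr₁` followed by `ℤ ≅ ℤˣ ≅ Aut(⋆)` (`Units.toAut`). [cite: MochizukiEtTh2009, Def 4.1 (ii) p.313 (PDF p.87)] -/
def rhoChain : Multiplicative ℤ × Mm →* Aut pt :=
  (Units.toAut (Multiplicative ℤ)).toMonoidHom.comp (toUnits.toMonoidHom.comp (MonoidHom.fst _ _))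

/-- `rhoChain` is surjective. [cite: MochizukiEtTh2009, Def 4.1 (ii) p.313 (PDF p.87)] -/
theorem rhoChain_surjective : Function.Surjective rhoChain := by
  intro g
  obtain ⟨u, rfl⟩ := (Units.toAut (Multiplicative ℤ)).surjective g
  obtain ⟨z, rfl⟩ := (toUnits (G := Multiplicative ℤ)).surjective u
  exact ⟨(z, 1), rfl⟩

/-- **The chain model** `chainTheta : ThetaFrobenioid (SingleObj ℤ) (SingleObj ℤ)` — every field of the DATA-ONLY §5 interface
supplied: `A_⊚ = A_N = B_N = ⋆`, `s^⊓_N = s^⊔_N = 𝟙`, `N = 2`, `l = 1`, `Π^tp_X = ℤ × ℤ/2` (discrete) ONTO `Aut_D(B_N^bs) ≅ ℤ`,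
`Π^tp_Ÿ = 1`, `K = 𝔽₂`, sections trivial; `Aut_C(A_⊚) ≅ ℤ` translates the chain. [cite: MochizukiEtTh2009, Prop 5.3 p.325 (PDF p.99)] -/
def chainTheta : ThetaFrobenioid.{0} TZ TZ where
  toTemperedFrobenioidStub := chainStub
  lDelta := fun _ => Unit
  lDeltaMap := fun _ => MonoidHom.id Unit
  l := 1
  odd_l := odd_one
  N := 2
  Acirc := pt
  AN := pt
  BN := pt
  sCap := 𝟙 pt
  sCup := 𝟙 pt
  base_map_sCap := rfl
  isPreStep_sCap := ⟨rfl, by change IsIso (𝟙 _); infer_instance⟩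
  isPreStep_sCup := ⟨rfl, by change IsIso (𝟙 _); infer_instance⟩
  PiX := Multiplicative ℤ × Mm
  zquot := MonoidHom.fst _ _
  zquot_surjective := fun z => ⟨(z, 1), rfl⟩
  PiYdd := ⊥
  PiYdd_le := bot_le
  relindex_PiYdd := by rw [Subgroup.relIndex_bot_left, Nat.card_congr kerFstEquiv, Nat.card_zmod]
  PiYdd_normal := inferInstance
  isOpen_PiYdd := isOpen_discrete _
  ρ := rhoChain
  ρ_surjective := rhoChain_surjective
  isOpen_ker_ρ := isOpen_discrete _
  strv := 1
  sgpCap := 1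
  sgpCup := 1
  K := ZMod 2
  constEmb := 1
  constEmb_injective := by
    intro a b _
    have h : ∀ u : (ZMod 2)ˣ, u = 1 := by decide
    rw [h a, h b]
  thetaFn := ()

/-- `Ψ := 𝟭_C`, the identity self-equivalence of the chain model's category. [cite: MochizukiEtTh2009, Prop 5.3 p.325 (PDF p.99)] -/
abbrev Ψ₁ : TZ ≌ TZ := CategoryTheory.Equivalence.refl

/-- `ι := 𝟙 : Ψ(A_⊚) = A_⊚ ⥲ A_⊚`, the chosen isomorphism for `Ψ = 𝟭`. [cite: MochizukiEtTh2009, Prop 5.3 p.325 (PDF p.99)] -/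
abbrev ι₁ : Ψ₁.functor.obj chainTheta.Acirc ≅ chainTheta.Acirc := Iso.refl pt

/-- In the chain model `Ψ^Φ_{A_⊚} = e` for `Ψ = 𝟭`, `ι = 𝟙` (pull-back along `𝟙 = 0 ∈ ℤ` is the identity). [cite: MochizukiEtTh2009, Prop 5.3 p.325 (PDF p.99)] -/
theorem psiPhi_chain (e : Φt ≃* Φt) : psiPhi chainTheta Ψ₁ ι₁ e = e :=
  MulEquiv.ext fun a => chainTheta.pre.pull_id _ (e a)

/-- **`Aut_C(A_⊚)` acts on `Φ(A_⊚)` by translating the chain**: `g` pulls back along `g⁻¹ ∈ ℤ`. [cite: MochizukiEtTh2009, Prop 5.3 (vi) p.326 (PDF p.100)] -/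
theorem pullAut_chain (g : Aut chainTheta.Acirc) (a : Φt) :
    chainTheta.pullAut g a = reindex (shift (Multiplicative.toAdd g.inv)) a := rfl

/-- Every translation of the chain is realised by an automorphism of `A_⊚`. [cite: MochizukiEtTh2009, §1 p.238 (PDF p.12)] -/
theorem exists_aut_translate (k : ℤ) : ∃ g : Aut chainTheta.Acirc, Multiplicative.toAdd g.inv = k :=
  ⟨⟨Multiplicative.ofAdd (-k), Multiplicative.ofAdd k,
    by rw [SingleObj.comp_as_mul, SingleObj.id_as_one, ← ofAdd_add, add_neg_cancel, ofAdd_zero],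
    by rw [SingleObj.comp_as_mul, SingleObj.id_as_one, ← ofAdd_add, neg_add_cancel, ofAdd_zero]⟩, rfl⟩

/-- **The prime data of the chain model**: f-009's canonical toy prime data on `Φ(A_⊚) = ⊕_{ℤ ⊔ ℤ} ℚ_{≥0}` — cuspidal primes
`P (inr n)`, non-cuspidal `P (inl n)`, CANONICAL component isomorphisms, `Prime^csp ↠ Prime^ncsp : P (inr n) ↦ P (inl n)` (the
component containing the cusp), labels `P (inl n) ↦ n`, `div(Θ̈) := [x_{inl 0}]`. [cite: MochizukiEtTh2009, Prop 5.3 p.325 (PDF p.99)] -/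
noncomputable def chainPrimeData : DivisorPrimeData chainTheta where
  IsCuspidalElt := toyPrimeData.IsCuspidalElt
  IsNonCuspidalElt := toyPrimeData.IsNonCuspidalElt
  IsCuspidal := IsCusp
  isCuspidal_iff := toyPrimeData.isCuspidal_iff
  ncspIso 𝔭 𝔮 _ _ := canonIso 𝔭 𝔮
  cspIso 𝔭 𝔮 _ _ := canonIso 𝔭 𝔮
  cspToNcsp := toyPrimeData.cspToNcsp
  cspToNcsp_surjective := toyPrimeData.cspToNcsp_surjective
  ncspEquivZ := toyPrimeData.ncspEquivZ
  divTheta := toyPrimeData.divTheta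

/-- **The transport stub of the chain model**: an isomorphism of divisor monoids "is induced by `Ψ`" iff it re-indexes along a chain
automorphism `(ε, c)` (reading of [FrdI] Thm. 4.9 at this datum: automorphisms act on the pointed dual graph). [cite: MochizukiEtTh2009, Prop 5.3 p.325 (PDF p.99)] -/
def chainTransport : DivisorTransportStub chainTheta where
  IsInducedBy := fun _ _ e => ∃ (ε : ℤˣ) (c : ℤ), ∀ a, e a = reindex (chainAut ε c) a

/-- The generator `x_{inl k}` of the component of index `inl k`. [cite: MochizukiEtTh2009, Prop 5.3 (vi) p.326 (PDF p.100)] -/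
abbrev xinl (k : ℤ) : Φt := DirectSum.single (M := Fac) (Sum.inl k) (Multiplicative.ofAdd 1)

/-- `reindex (chainAut ε c)` moves `x_{inl k}` to `x_{inl (εk + c)}` (so it is `≠ id` unless `(ε, c) = (1, 0)`). [cite: MochizukiEtTh2009, Prop 5.3 (vi) p.326 (PDF p.100)] -/
theorem reindex_chainAut_xinl (ε : ℤˣ) (c k : ℤ) : reindex (chainAut ε c) (xinl k) = xinl (ε * k + c) := by
  rw [reindex_single, chainAut_inl]

/-- The value of the canonical component isomorphism: `canonIso 𝔭 𝔮 x = x_{idx 𝔭} · [idx 𝔮]`. [cite: MochizukiEtTh2009, Prop 5.3 (ii) p.325 (PDF p.99)] -/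
theorem canonIso_val (𝔭 𝔮 : Primes Φt) (x : ↥𝔭.submonoid) :
    ((canonIso 𝔭 𝔮 x : ↥𝔮.submonoid) : Φt) = DirectSum.single (M := Fac) (idx 𝔮) (((x : Φt) : ∀ j, Fac j) (idx 𝔭)) := rfl

/-- **Any re-indexing is compatible with the canonical component isomorphisms** (the heart of (ii)/(iii) at the model):
`ψ ∘ ι_{𝔭,𝔮} = ι_{ψ𝔭,ψ𝔮} ∘ ψ` on `Φ_𝔭` for `ψ = reindex σ`. [cite: MochizukiEtTh2009, Prop 5.3 (ii) p.325 (PDF p.99)] -/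
theorem reindex_canonIso (σ : Idx ≃ Idx) (ψ : Φt ≃* Φt) (hψ : ψ = reindex σ) (𝔭 𝔮 : Primes Φt) (x : ↥𝔭.submonoid) :
    ψ ((canonIso 𝔭 𝔮 x : ↥𝔮.submonoid) : Φt) =
      ((canonIso (Primes.congr ψ 𝔭) (Primes.congr ψ 𝔮) (Primes.submonoidCongr ψ 𝔭 _ rfl x) :
        ↥(Primes.congr ψ 𝔮).submonoid) : Φt) := by
  subst hψ
  rw [canonIso_val, canonIso_val, reindex_single, idx_congr_reindex, idx_congr_reindex,
    Primes.coe_submonoidCongr_apply, reindex_apply, Equiv.symm_apply_apply]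

/-- A chain automorphism `ψ = reindex (chainAut ε c)` preserves cuspidality of primes. [cite: MochizukiEtTh2009, Prop 5.3 (i) p.325 (PDF p.99)] -/
theorem isCusp_congr_chainAut (ε : ℤˣ) (c : ℤ) (ψ : Φt ≃* Φt) (hψ : ψ = reindex (chainAut ε c)) (𝔭 : Primes Φt) :
    IsCusp (Primes.congr ψ 𝔭) ↔ IsCusp 𝔭 := by
  subst hψ
  constructor
  · rintro ⟨m, hm⟩
    rcases h : idx 𝔭 with n | n
    · rw [idx_congr_reindex, h, chainAut_inl] at hm
      exact absurd hm Sum.inl_ne_inr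
    · exact ⟨n, h⟩
  · rintro ⟨n, hn⟩
    exact ⟨_, by rw [idx_congr_reindex, hn, chainAut_inr]⟩

/-- If `ψ` respects a property `Q` of primes, then "`a` lies only in `Q`-primes" iff "`ψ a` does" ((i) on elements from (i) on
primes). [cite: MochizukiEtTh2009, Prop 5.3 (i) p.325 (PDF p.99)] -/
theorem forall_mem_carrier_congr {ψ : Φt ≃* Φt} {Q : Primes Φt → Prop} (hψ : ∀ 𝔭, Q (Primes.congr ψ 𝔭) ↔ Q 𝔭) (a : Φt) :
    (∀ 𝔭 : Primes Φt, a ∈ 𝔭.carrier → Q 𝔭) ↔ ∀ 𝔮 : Primes Φt, ψ a ∈ 𝔮.carrier → Q 𝔮 := by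
  constructor
  · intro h 𝔮 h𝔮
    rw [← Primes.congr_apply_congr_symm ψ 𝔮, Primes.mem_carrier_congr_iff, ψ.symm_apply_apply] at h𝔮
    rw [← Primes.congr_apply_congr_symm ψ 𝔮]
    exact (hψ _).mpr (h _ h𝔮)
  · intro h 𝔭 h𝔭
    have h' : ψ a ∈ (Primes.congr ψ 𝔭).carrier := by rw [Primes.mem_carrier_congr_iff, ψ.symm_apply_apply]; exact h𝔭
    exact (hψ 𝔭).mp (h _ h')

/-- The label of a prime of index `inl n` or `inr n` is `n`. [cite: MochizukiEtTh2009, Prop 5.3 (v) p.325 (PDF p.99)] -/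
theorem label_of_idx {𝔭 : Primes Φt} {n : ℤ} (h : idx 𝔭 = Sum.inl n ∨ idx 𝔭 = Sum.inr n) : label 𝔭 = n := by
  rcases h with h | h <;> simp [label, h]

/-- (iv) in index form: for `𝔭 = P (inr n)` and `ψ = reindex (chainAut ε c)`, the component of the cusp `ψ𝔭` is `ψ` of the component
of `𝔭` (both are `P (inl (εn + c))`). [cite: MochizukiEtTh2009, Prop 5.3 (iv) p.325 (PDF p.99)] -/
theorem cspToNcsp_congr_chainAut (ε : ℤˣ) (c : ℤ) (ψ : Φt ≃* Φt) (hψ : ψ = reindex (chainAut ε c)) {𝔭 : Primes Φt}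
    {n : ℤ} (hn : idx 𝔭 = Sum.inr n) : P (Sum.inl (label (Primes.congr ψ 𝔭))) = Primes.congr ψ (P (Sum.inl (label 𝔭))) := by
  subst hψ
  rw [label_of_idx (Or.inr (by rw [idx_congr_reindex, hn, chainAut_inr])), congr_reindex_P, chainAut_inl,
    label_of_idx (Or.inr hn)]

/-- (v) in index form: for `𝔭 = P (inl n)` and `ψ = reindex (chainAut ε c)`, `label (ψ𝔭) = ε · label 𝔭 + c`. [cite: MochizukiEtTh2009, Prop 5.3 (v) p.325 (PDF p.99)] -/
theorem label_congr_chainAut (ε : ℤˣ) (c : ℤ) (ψ : Φt ≃* Φt) (hψ : ψ = reindex (chainAut ε c)) {𝔭 : Primes Φt} {n : ℤ}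
    (hn : idx 𝔭 = Sum.inl n) : label (Primes.congr ψ 𝔭) = ε * label 𝔭 + c := by
  subst hψ
  rw [label_of_idx (Or.inl (by rw [idx_congr_reindex, hn, chainAut_inl])), label_of_idx (Or.inl hn)]

/-- `g ∈ Aut_C(A_⊚)` moves `div(Θ̈) = [x_{inl 0}]` to `[x_{inl g⁻¹}]` in `Φ(A_⊚)^gp`. [cite: MochizukiEtTh2009, Prop 5.3 (vi) p.326 (PDF p.100)] -/
theorem gpMap_pullAut_divTheta (g : Aut chainTheta.Acirc) :
    ThetaFrobenioid.gpMap (chainTheta.pullAut g : chainTheta.PhiAcirc →* chainTheta.PhiAcirc) chainPrimeData.divTheta =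
      Algebra.GrothendieckGroup.of (xinl (Multiplicative.toAdd g.inv)) := by
  have h : chainTheta.pullAut g (xinl 0) = xinl (Multiplicative.toAdd g.inv) := by
    rw [pullAut_chain, reindex_chainAut_xinl, Units.val_one, one_mul, zero_add]
  exact (ThetaFrobenioid.gpMap_of _ (xinl 0)).trans (congrArg Algebra.GrothendieckGroup.of h)

/-- **The orbit is the whole chain**: `Aut_C(A_⊚) · div(Θ̈) = {[x_{inl k}] | k ∈ ℤ}` in `Φ(A_⊚)^gp`. [cite: MochizukiEtTh2009, Prop 5.3 (vi) p.326 (PDF p.100)] -/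
theorem thetaOrbit_eq :
    (Set.range fun g : Aut chainTheta.Acirc =>
        ThetaFrobenioid.gpMap (chainTheta.pullAut g : chainTheta.PhiAcirc →* chainTheta.PhiAcirc) chainPrimeData.divTheta) =
      Set.range fun k : ℤ => Algebra.GrothendieckGroup.of (xinl k) := by
  ext z
  refine ⟨fun ⟨g, hg⟩ => ⟨_, (gpMap_pullAut_divTheta g).symm.trans hg⟩, fun ⟨k, hk⟩ => ?_⟩
  obtain ⟨g, hg⟩ := exists_aut_translate k
  exact ⟨g, ((gpMap_pullAut_divTheta g).trans (congrArg (fun k => Algebra.GrothendieckGroup.of (xinl k)) hg)).trans hk⟩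

/-- A chain automorphism carries the chain `{[x_{inl k}] | k ∈ ℤ}` onto itself. [cite: MochizukiEtTh2009, Prop 5.3 (vi) p.327 (PDF p.101)] -/
theorem image_chain_eq (ε : ℤˣ) (c : ℤ) (ψ : Φt ≃* Φt) (hψ : ψ = reindex (chainAut ε c)) :
    ThetaFrobenioid.gpMap (ψ : Φt →* Φt) '' (Set.range fun k : ℤ => Algebra.GrothendieckGroup.of (xinl k)) =
      Set.range fun k : ℤ => Algebra.GrothendieckGroup.of (xinl k) := by
  subst hψ
  have key : ∀ k : ℤ, ThetaFrobenioid.gpMap (reindex (chainAut ε c) : Φt →* Φt) (Algebra.GrothendieckGroup.of (xinl k)) =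
      Algebra.GrothendieckGroup.of (xinl (ε * k + c)) := fun k => by
    rw [ThetaFrobenioid.gpMap_of, MonoidHom.coe_coe, reindex_chainAut_xinl]
  ext z
  constructor
  · rintro ⟨_, ⟨k, rfl⟩, rfl⟩
    exact ⟨ε * k + c, (key k).symm⟩
  · rintro ⟨k, rfl⟩
    refine ⟨Algebra.GrothendieckGroup.of (xinl (ε * (k - c))), ⟨_, rfl⟩, ?_⟩
    rw [key, ← mul_assoc, Int.units_coe_mul_self, one_mul, sub_add_cancel]

/-! ### Proposition 5.3 (i)–(vi) HOLD at the chain model for every chain automorphism `e = (ε, c)` -/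

/-- **(i), prime level**: `Ψ^Φ_{A_⊚} = reindex (chainAut ε c)` preserves the cuspidal primes. [cite: MochizukiEtTh2009, Prop 5.3 (i) p.325 (PDF p.99)] -/
theorem cuspPreserved_chain (ε : ℤˣ) (c : ℤ) : CuspPreserved chainPrimeData Ψ₁ ι₁ (reindex (chainAut ε c)) :=
  fun 𝔭 => isCusp_congr_chainAut ε c _ (psiPhi_chain _) 𝔭

/-- **[EtTh] Prop. 5.3 (i) at the chain model (row F-0561)**, for every transport stub `T`: `Ψ^Φ_{A_⊚}` preserves
non-cuspidal and cuspidal elements and primes. [cite: MochizukiEtTh2009, Prop 5.3 (i) p.325 (PDF p.99)] -/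
theorem preservesCuspidality_chain (ε : ℤˣ) (c : ℤ) (T : DivisorTransportStub chainTheta) :
    Literature.AnabelianGeometry.EtaleTheta.FrobenioidThetaDivisors.PreservesCuspidality T chainPrimeData Ψ₁ ι₁
      (reindex (chainAut ε c)) :=
  fun _ =>
    have hc := isCusp_congr_chainAut ε c _ (psiPhi_chain (reindex (chainAut ε c)))
    ⟨fun a => forall_mem_carrier_congr (Q := fun 𝔭 => ¬ IsCusp 𝔭) (fun 𝔭 => not_congr (hc 𝔭)) a,
      fun a => forall_mem_carrier_congr (Q := IsCusp) hc a, cuspPreserved_chain ε c⟩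

/-- **[EtTh] Prop. 5.3 (ii) at the chain model (row F-0562)**: `Ψ^Φ_{A_⊚}` is compatible with the canonical isomorphisms
between distinct non-cuspidal primary components. [cite: MochizukiEtTh2009, Prop 5.3 (ii) p.325 (PDF p.99)] -/
theorem preservesNcspComponentIsos_chain (ε : ℤˣ) (c : ℤ) :
    Literature.AnabelianGeometry.EtaleTheta.FrobenioidThetaDivisors.PreservesNcspComponentIsos chainPrimeData Ψ₁ ι₁
      (reindex (chainAut ε c)) (cuspPreserved_chain ε c) :=
  fun 𝔭 𝔮 _ _ _ x => reindex_canonIso (chainAut ε c) _ (psiPhi_chain _) 𝔭 𝔮 x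

/-- **[EtTh] Prop. 5.3 (iii) at the chain model (row F-0559)**: `Ψ^Φ_{A_⊚}` is compatible with the canonical isomorphisms
between distinct cuspidal primary components. [cite: MochizukiEtTh2009, Prop 5.3 (iii) p.325 (PDF p.99)] -/
theorem preservesCspComponentIsos_chain (ε : ℤˣ) (c : ℤ) :
    Literature.AnabelianGeometry.EtaleTheta.FrobenioidThetaDivisors.PreservesCspComponentIsos chainPrimeData Ψ₁ ι₁
      (reindex (chainAut ε c)) (cuspPreserved_chain ε c) :=
  fun 𝔭 𝔮 _ _ _ x => reindex_canonIso (chainAut ε c) _ (psiPhi_chain _) 𝔭 𝔮 x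

/-- **[EtTh] Prop. 5.3 (iv) at the chain model (row F-0560)**: `Ψ^Φ_{A_⊚}` is compatible with the surjection `Prime^csp ↠
Prime^ncsp`, `P (inr n) ↦ P (inl n)`. [cite: MochizukiEtTh2009, Prop 5.3 (iv) p.325 (PDF p.99)] -/
theorem preservesCspToNcsp_chain (ε : ℤˣ) (c : ℤ) :
    Literature.AnabelianGeometry.EtaleTheta.FrobenioidThetaDivisors.PreservesCspToNcsp chainPrimeData Ψ₁ ι₁
      (reindex (chainAut ε c)) (cuspPreserved_chain ε c) := by
  rintro 𝔭 ⟨n, hn⟩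
  exact cspToNcsp_congr_chainAut ε c _ (psiPhi_chain _) hn

/-- **[EtTh] Prop. 5.3 (v) at the chain model (row F-0563)**: `Ψ^Φ_{A_⊚}` acts on the labels `Prime^ncsp ⥲ ℤ` by
`n ↦ εn + c` — "translation by an element of `ℤ` and multiplication by `±1`". [cite: MochizukiEtTh2009, Prop 5.3 (v) p.325 (PDF p.99)] -/
theorem preservesNcspLabels_chain (ε : ℤˣ) (c : ℤ) :
    Literature.AnabelianGeometry.EtaleTheta.FrobenioidThetaDivisors.PreservesNcspLabels chainPrimeData Ψ₁ ι₁
      (reindex (chainAut ε c)) (cuspPreserved_chain ε c) := by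
  refine ⟨ε, c, fun 𝔭 h𝔭 => ?_⟩
  obtain ⟨n, hn⟩ := idx_eq_inl_of_not_isCusp h𝔭
  exact label_congr_chainAut ε c _ (psiPhi_chain _) hn

/-- **[EtTh] Prop. 5.3 (vi) at the chain model (row F-0564)**: `Ψ^Φ_{A_⊚}` carries the `Aut_C(A_⊚)`-orbit `{[x_{inl k}] | k ∈ ℤ}`
of `div(Θ̈)` — ALL translates, a non-degenerate orbit — onto itself. [cite: MochizukiEtTh2009, Prop 5.3 (vi) p.326 (PDF p.100)] -/
theorem preservesThetaDivisorOrbit_chain (ε : ℤˣ) (c : ℤ) :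
    Literature.AnabelianGeometry.EtaleTheta.FrobenioidThetaDivisors.PreservesThetaDivisorOrbit chainPrimeData Ψ₁ ι₁
      (reindex (chainAut ε c)) := by
  change _ '' _ = _
  rw [thetaOrbit_eq]
  exact image_chain_eq ε c _ (psiPhi_chain _)

/-- **[EtTh] Prop. 5.3, all six parts, at the chain model (row F-2497)**: `GeometryOfDivisorsPreserved` for the transport stub
"`e` is a chain automorphism", the canonical prime data, `Ψ = 𝟭`, `ι = 𝟙`, `e = reindex (chainAut ε c)`, EVERY `ε = ±1`, `c ∈ ℤ`.
[cite: MochizukiEtTh2009, Prop 5.3 p.325–326 (PDF pp.99–100)] -/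
theorem geometryOfDivisorsPreserved_chain (ε : ℤˣ) (c : ℤ) :
    Literature.AnabelianGeometry.EtaleTheta.FrobenioidThetaDivisors.GeometryOfDivisorsPreserved chainTransport
      chainPrimeData Ψ₁ ι₁ (reindex (chainAut ε c)) :=
  have hi := preservesCuspidality_chain ε c chainTransport ⟨ε, c, fun _ => rfl⟩
  { induced := ⟨ε, c, fun _ => rfl⟩
    elements := ⟨hi.1, hi.2.1⟩
    primes := cuspPreserved_chain ε c
    ncspIsos := preservesNcspComponentIsos_chain ε c
    cspIsos := preservesCspComponentIsos_chain ε c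
    cspToNcsp := preservesCspToNcsp_chain ε c
    labels := preservesNcspLabels_chain ε c
    thetaOrbit := preservesThetaDivisorOrbit_chain ε c }

/-- **Every `e` admitted by the chain model's transport stub satisfies Prop. 5.3 (i)–(vi)** (`Ψ = 𝟭`, `ι = 𝟙`): the INSTANCE
FORM of row F-2497 at this datum — whereas the universal closure over ALL `e` / prime data fails (abc-iut-f-009,
`Sec5Prop53UniversalClosureRefuted.lean`). [cite: MochizukiEtTh2009, Prop 5.3 p.325–326 (PDF pp.99–100)] -/
theorem geometryOfDivisorsPreserved_of_isInducedBy
    (e : chainTheta.PhiAcirc ≃* chainTheta.pre.Mon (chainTheta.base.obj (Ψ₁.functor.obj chainTheta.Acirc)))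
    (he : chainTransport.IsInducedBy Ψ₁ chainTheta.Acirc e) :
    Literature.AnabelianGeometry.EtaleTheta.FrobenioidThetaDivisors.GeometryOfDivisorsPreserved chainTransport
      chainPrimeData Ψ₁ ι₁ e := by
  obtain ⟨ε, c, h⟩ := he
  obtain rfl : e = reindex (chainAut ε c) := MulEquiv.ext h
  exact geometryOfDivisorsPreserved_chain ε c

end Literature.AnabelianGeometry.EtaleTheta.FrobenioidThetaDivisors.Prop53Chain
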